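import Mathlib
import HarnessLib
import Summits.ValiantsHypothesis.ValiantsHypothesis.Theorems.LacunarySymmetroidMatrixDescartesProductPlusOneEulerMiddleOuterRatio

/-!
# ValiantsHypothesis / LacunarySymmetroid — crux `MatrixDescartes` (stmt-ValiantsHypothesis-18050, V1), LINE (A) «product_plus_one»,
# research stubs `stub_classRowK3` / `stub_eulerBoundK3`: the TOP COUPLING for rows with a NEGATIVE MIDDLE LETTER over a positive bottom
# letter (zero-free valley rows `(+,−,+)`) — localisation between the extreme top brackets and the COMMON-BOTTOM-RATIO law `Z₊ = 1`

Third panel of the bracket calculus of the two-change («zero-free strict dip» / VALLEY) residue of S4′/S4″ (✓ `…ZeroChangeValleyBottoms`: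
bottom coupling `l₀ = 0`; ✓ `…ProductPlusOneEulerMiddleOuterRatio`: middle coupling `l₀ = 1` and the every-format termwise sign law
`euler_eval_{pos,neg,eq_zero}_of_letters_*` reused here).  At the TOP coupling `l₀ = 2` the Euler letter of a trinomial row is
`B_j(x) = −x^{d₀}·I_j(x)`, `I_j(x) = (d₂−d₀)·a_{j0} + (d₂−d₁)·a_{j1}·x^{d₁−d₀}` — it does not see the top letter, and for a NEGATIVE middle
letter `a_{j1} < 0` the inner bracket `I_j` is strictly DECREASING, with a unique positive zero when `a_{j0} > 0` (the TOP BRACKET POINT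
`y_j`, `y_j^{d₁−d₀} = (d₂−d₀)a_{j0}/((d₂−d₁)|a_{j1}|)`):

* `eval_eulerLetter_top`, `topBracket_lt`, `topBracket_root_unique`, `exists_topBracket_root` — the letter and its inner bracket;
* ★ `euler_top_roots_between_brackets` — **LOCALISATION**: negative middle letters, factors zero-free on `(0,∞)`; inner brackets `≥ 0` at `τ₁`
  and `≤ 0` at `τ₂` ⇒ every positive root of the top-coupling Euler numerator lies in `[τ₁, τ₂]` — every `m`, every support, top letters arbitrary;
* ★★ `euler_top_eq_bracket_mul_of_bottomRatio` — **COMMON-BOTTOM-RATIO FACTORISATION** (pure algebra): `a_{j0} = −κ·a_{j1}` for all `j` ⇒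
  `E = (C((d₂−d₀)κ)·X^{d₀} + C(−(d₂−d₁))·X^{d₁}) · Σ_j C(a_{j1}) ∏_{i≠j} f_i`;
* ★★ `euler_top_card_posRoots_le_one_of_bottomRatio` / `…_eq_one_of_bottomRatio` — **COMMON-BOTTOM-RATIO LAW**: zero-free rows with
  `a_{j1} < 0`, `a_{j0} = −κ·a_{j1}` (`κ > 0`) have EXACTLY ONE positive Euler root at the top coupling (`m ≥ 1`; `≤ 1` for every `m`) —
  every `m`, every support `d₀ < d₁ < d₂`, top letters arbitrary (subject to zero-freeness).

With the two companions: at EACH coupling `l₀ ∈ {0,1,2}` the Euler roots of a zero-free valley company are confined to the spread of the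
relevant bracket points (bottoms `τ_j` / outer bottoms `x_j` / top points `y_j`), and a company with a common value of the relevant letter
ratio (`a_{j1}:a_{j2}` / `a_{j0}:a_{j2}` / `a_{j0}:a_{j1}`) has exactly one Euler root there.  LOCATED, NOT PROVED (this seat, exact sign
counts on random zero-free valley companies, `m ≤ 6`, ratios `d₂−d₀ : d₁−d₀ ∈ {1.5,…,17}`): the count inside the spread never exceeded
`2m − 1` at `l₀ = 0, 1` (attained by scale-separated valleys: `m` minima, `m − 1` maxima); Descartes allows `Θ(m²)` there.  OPEN for the stubs
in this cell: `Z₊ ≤ 2m − 1` (or any bound linear in `m`) inside the spread.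

HONEST FRAMING: helper / sector theorems, def-free, no named facts, no `sorry`, standard axioms; closes NO stub by name; `OneChangeFloorK3`,
`EulerBoundK3`, `ClassRowK3Linear`, `PPOPolyLaw`, `MatrixDescartes` (stmt-ValiantsHypothesis-18050) stay OPEN; `VP ≠ VNP` is NOT proved and
nothing here bears on it.  [folklore] Elementary algebra of sparse polynomials; no citation needed.
-/

set_option linter.dupNamespace false

namespace Summit.ValiantsHypothesis.ValiantsHypothesis.Theorems.LacunarySymmetroidMatrixDescartes

namespace ProductPlusOne

open Polynomial Finset
open scoped BigOperators

/-! ## §1 The top Euler letter and its inner bracket -/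

/-- The top Euler letter of a trinomial row: `B_j(x) = −x^{d₀}·((d₂−d₀)·a_{j0} + (d₂−d₁)·a_{j1}·x^{d₁−d₀})` (`d₀ ≤ d₁`; the top letter
`a_{j2}` does not occur). [folklore] -/
theorem eval_eulerLetter_top (d : Fin 3 → ℕ) (h01 : d 0 ≤ d 1) (b : Fin 3 → ℝ) (x : ℝ) :
    ∑ l, b l * ((d l : ℝ) - d 2) * x ^ (d l)
      = -(x ^ (d 0) * (((d 2 : ℝ) - d 0) * b 0 + ((d 2 : ℝ) - d 1) * b 1 * x ^ (d 1 - d 0))) := by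
  rw [Fin.sum_univ_three]
  have h : x ^ (d 1) = x ^ (d 0) * x ^ (d 1 - d 0) := by rw [← pow_add, Nat.add_sub_cancel' h01]
  rw [h]
  ring

/-- The inner top bracket `(d₂−d₀)·a₀ + (d₂−d₁)·a₁·x^{d₁−d₀}` is strictly DECREASING on `[0,∞)` when `a₁ < 0` (`d₀ < d₁ < d₂`). [folklore] -/
theorem topBracket_lt (d : Fin 3 → ℕ) (h01 : d 0 < d 1) (h12 : d 1 < d 2) (b0 : ℝ) {b1 : ℝ} (hb1 : b1 < 0) {x y : ℝ}
    (hx : 0 ≤ x) (hxy : x < y) :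
    ((d 2 : ℝ) - d 0) * b0 + ((d 2 : ℝ) - d 1) * b1 * y ^ (d 1 - d 0)
      < ((d 2 : ℝ) - d 0) * b0 + ((d 2 : ℝ) - d 1) * b1 * x ^ (d 1 - d 0) := by
  have hw : (0 : ℝ) < (d 2 : ℝ) - d 1 := by
    have : (d 1 : ℝ) < d 2 := by exact_mod_cast h12
    linarith
  have hpow : x ^ (d 1 - d 0) < y ^ (d 1 - d 0) := pow_lt_pow_left₀ hxy hx (by omega)
  nlinarith [mul_lt_mul_of_pos_left hpow (mul_pos hw (neg_pos.2 hb1))]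

/-- The top bracket point is unique (`a₁ < 0`). [folklore] -/
theorem topBracket_root_unique (d : Fin 3 → ℕ) (h01 : d 0 < d 1) (h12 : d 1 < d 2) (b0 : ℝ) {b1 : ℝ} (hb1 : b1 < 0)
    {x y : ℝ} (hx : 0 < x) (hy : 0 < y)
    (hxr : ((d 2 : ℝ) - d 0) * b0 + ((d 2 : ℝ) - d 1) * b1 * x ^ (d 1 - d 0) = 0)
    (hyr : ((d 2 : ℝ) - d 0) * b0 + ((d 2 : ℝ) - d 1) * b1 * y ^ (d 1 - d 0) = 0) : x = y := by
  rcases lt_trichotomy x y with hlt | heq | hgt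
  · linarith [topBracket_lt d h01 h12 b0 hb1 hx.le hlt]
  · exact heq
  · linarith [topBracket_lt d h01 h12 b0 hb1 hy.le hgt]

/-- Existence of the top bracket point for `a₀ > 0 > a₁`: `y^{d₁−d₀} = (d₂−d₀)a₀/((d₂−d₁)(−a₁))`. [folklore] -/
theorem exists_topBracket_root (d : Fin 3 → ℕ) (h01 : d 0 < d 1) (h12 : d 1 < d 2) {b0 b1 : ℝ} (hb0 : 0 < b0) (hb1 : b1 < 0) :
    ∃ x : ℝ, 0 < x ∧ ((d 2 : ℝ) - d 0) * b0 + ((d 2 : ℝ) - d 1) * b1 * x ^ (d 1 - d 0) = 0 := by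
  have hw0 : (0 : ℝ) < (d 2 : ℝ) - d 0 := by
    have : (d 0 : ℝ) < d 2 := by exact_mod_cast (h01.trans h12)
    linarith
  have hw1 : (0 : ℝ) < (d 2 : ℝ) - d 1 := by
    have : (d 1 : ℝ) < d 2 := by exact_mod_cast h12
    linarith
  set y : ℝ := ((d 2 : ℝ) - d 0) * b0 / (((d 2 : ℝ) - d 1) * (-b1)) with hy
  have hypos : 0 < y := div_pos (mul_pos hw0 hb0) (mul_pos hw1 (neg_pos.2 hb1))
  have hne : d 1 - d 0 ≠ 0 := by omega
  refine ⟨y ^ ((d 1 - d 0 : ℕ) : ℝ)⁻¹, Real.rpow_pos_of_pos hypos _, ?_⟩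
  rw [Real.rpow_inv_natCast_pow hypos.le hne, hy]
  have hb1' : b1 ≠ 0 := hb1.ne
  field_simp
  ring

/-! ## §2 Localisation of the top-coupling Euler roots between the extreme top bracket points -/

/-- ★ **LOCALISATION AT THE TOP COUPLING**: `K = 3`, `d₀ < d₁ < d₂`, negative middle letters `a_{j1} < 0`, factors zero-free on `(0,∞)`;
if every inner top bracket is `≥ 0` at `τ₁` and `≤ 0` at `τ₂ > 0`, every positive root of the top-coupling Euler numerator lies in `[τ₁, τ₂]`
— every `m`, no ratio window, top letters arbitrary. [folklore] -/
theorem euler_top_roots_between_brackets {m : ℕ} (d : Fin 3 → ℕ) (h01 : d 0 < d 1) (h12 : d 1 < d 2)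
    (a : Fin m → Fin 3 → ℝ) (hmid : ∀ j, a j 1 < 0)
    (hpos : ∀ i, ∀ x : ℝ, 0 < x → 0 < ∑ l, a i l * x ^ (d l))
    {τ₁ τ₂ : ℝ} (hτ₂ : 0 < τ₂)
    (h₁ : ∀ j, 0 ≤ ((d 2 : ℝ) - d 0) * a j 0 + ((d 2 : ℝ) - d 1) * a j 1 * τ₁ ^ (d 1 - d 0))
    (h₂ : ∀ j, ((d 2 : ℝ) - d 0) * a j 0 + ((d 2 : ℝ) - d 1) * a j 1 * τ₂ ^ (d 1 - d 0) ≤ 0) :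
    ∀ x ∈ ((∑ j, (∑ l, C (a j l * ((d l : ℝ) - d 2)) * X ^ (d l)) * ∏ i ∈ Finset.univ.erase j, (∑ l, C (a i l) * X ^ (d l))
        : ℝ[X]).roots.toFinset.filter (fun t => 0 < t)), τ₁ ≤ x ∧ x ≤ τ₂ := by
  classical
  intro x hx
  simp only [mem_filter, Multiset.mem_toFinset] at hx
  obtain ⟨hroot, hxpos⟩ := hx
  have hne := (mem_roots'.1 hroot).1
  have hE : ((∑ j, (∑ l, C (a j l * ((d l : ℝ) - d 2)) * X ^ (d l)) * ∏ i ∈ Finset.univ.erase j, (∑ l, C (a i l) * X ^ (d l))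
      : ℝ[X])).eval x = 0 := (mem_roots'.1 hroot).2
  have hm : 0 < m := by
    rcases Nat.eq_zero_or_pos m with rfl | hm
    · exact absurd (by simp) hne
    · exact hm
  have hxd : 0 < x ^ (d 0) := pow_pos hxpos _
  constructor
  · by_contra hlt
    push Not at hlt
    have hB : ∀ j, ∑ l, a j l * ((d l : ℝ) - d 2) * x ^ (d l) < 0 := by
      intro j
      rw [eval_eulerLetter_top d h01.le]
      refine neg_neg_of_pos (mul_pos hxd ?_)
      exact lt_of_le_of_lt (h₁ j) (topBracket_lt d h01 h12 (a j 0) (hmid j) hxpos.le hlt)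
    exact (euler_eval_neg_of_letters_neg hm d a 2 (fun i => hpos i x hxpos) hB).ne hE
  · by_contra hlt
    push Not at hlt
    have hB : ∀ j, 0 < ∑ l, a j l * ((d l : ℝ) - d 2) * x ^ (d l) := by
      intro j
      rw [eval_eulerLetter_top d h01.le]
      refine neg_pos.2 (mul_neg_of_pos_of_neg hxd ?_)
      exact lt_of_lt_of_le (topBracket_lt d h01 h12 (a j 0) (hmid j) hτ₂.le hlt) (h₂ j)
    exact (euler_eval_pos_of_letters_pos hm d a 2 (fun i => hpos i x hxpos) hB).ne' hE

/-! ## §3 The common-bottom-ratio factorisation and the exact count -/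

/-- ★★ **COMMON-BOTTOM-RATIO FACTORISATION** (pure algebra): if `a_{j0} = −κ·a_{j1}` for every row, the top-coupling Euler numerator is
the BINOMIAL `C((d₂−d₀)κ)·X^{d₀} + C(−(d₂−d₁))·X^{d₁}` times `Σ_j C(a_{j1})·∏_{i≠j} f_i` — any `κ`, any top letters, factors may vanish. [folklore] -/
theorem euler_top_eq_bracket_mul_of_bottomRatio {m : ℕ} (d : Fin 3 → ℕ) (a : Fin m → Fin 3 → ℝ) (κ : ℝ)
    (hratio : ∀ j, a j 0 = -κ * a j 1) :
    ((∑ j, (∑ l, C (a j l * ((d l : ℝ) - d 2)) * X ^ (d l)) * ∏ i ∈ Finset.univ.erase j, (∑ l, C (a i l) * X ^ (d l)) : ℝ[X]))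
      = (C (((d 2 : ℝ) - d 0) * κ) * X ^ (d 0) + C (-((d 2 : ℝ) - d 1)) * X ^ (d 1)) *
          ∑ j, C (a j 1) * ∏ i ∈ Finset.univ.erase j, (∑ l, C (a i l) * X ^ (d l)) := by
  classical
  rw [mul_sum]
  refine sum_congr rfl fun j _ => ?_
  have hletter : (∑ l, C (a j l * ((d l : ℝ) - d 2)) * X ^ (d l) : ℝ[X])
      = (C (((d 2 : ℝ) - d 0) * κ) * X ^ (d 0) + C (-((d 2 : ℝ) - d 1)) * X ^ (d 1)) * C (a j 1) := by
    rw [Fin.sum_univ_three, hratio j]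
    simp only [C_mul, C_sub, C_neg]
    ring
  rw [hletter, mul_assoc]

/-- The companion sum `Σ_j a_{j1}·∏_{i≠j} f_i(x)` is negative where all factors are positive and the middle letters negative (`m ≥ 1`). [folklore] -/
theorem eval_middleWeightedSum_neg {m : ℕ} (hm : 0 < m) (d : Fin 3 → ℕ) (a : Fin m → Fin 3 → ℝ) (hmid : ∀ j, a j 1 < 0) {x : ℝ}
    (hf : ∀ i, 0 < ∑ l, a i l * x ^ (d l)) :
    (∑ j, C (a j 1) * ∏ i ∈ Finset.univ.erase j, (∑ l, C (a i l) * X ^ (d l)) : ℝ[X]).eval x < 0 := by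
  classical
  have hev : (∑ j, C (a j 1) * ∏ i ∈ Finset.univ.erase j, (∑ l, C (a i l) * X ^ (d l)) : ℝ[X]).eval x
      = ∑ j, a j 1 * ∏ i ∈ Finset.univ.erase j, (∑ l, a i l * x ^ (d l)) := by
    simp [eval_finsetSum, eval_prod]
  rw [hev]
  haveI : Nonempty (Fin m) := ⟨⟨0, hm⟩⟩
  exact sum_neg (fun j _ => mul_neg_of_neg_of_pos (hmid j) (prod_pos fun i _ => hf i)) univ_nonempty

/-- ★★ **COMMON-BOTTOM-RATIO LAW (upper bound)**: `d₀ < d₁ < d₂`, `a_{j1} < 0`, `a_{j0} = −κ·a_{j1}`, factors zero-free on `(0,∞)` ⇒ the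
top-coupling Euler numerator has AT MOST ONE positive root — every `m`, top letters arbitrary. [folklore] -/
theorem euler_top_card_posRoots_le_one_of_bottomRatio {m : ℕ} (d : Fin 3 → ℕ) (h01 : d 0 < d 1) (h12 : d 1 < d 2)
    (a : Fin m → Fin 3 → ℝ) (hmid : ∀ j, a j 1 < 0) (κ : ℝ) (hratio : ∀ j, a j 0 = -κ * a j 1)
    (hpos : ∀ i, ∀ x : ℝ, 0 < x → 0 < ∑ l, a i l * x ^ (d l)) :
    ((∑ j, (∑ l, C (a j l * ((d l : ℝ) - d 2)) * X ^ (d l)) * ∏ i ∈ Finset.univ.erase j, (∑ l, C (a i l) * X ^ (d l))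
        : ℝ[X]).roots.toFinset.filter (fun t => 0 < t)).card ≤ 1 := by
  classical
  rcases Nat.eq_zero_or_pos m with rfl | hm
  · simp
  have key : ∀ x : ℝ, 0 < x →
      ((∑ j, (∑ l, C (a j l * ((d l : ℝ) - d 2)) * X ^ (d l)) * ∏ i ∈ Finset.univ.erase j, (∑ l, C (a i l) * X ^ (d l))
        : ℝ[X])).eval x = 0 →
      ((d 2 : ℝ) - d 0) * κ + ((d 2 : ℝ) - d 1) * (-1) * x ^ (d 1 - d 0) = 0 := by
    intro x hx hE
    rw [euler_top_eq_bracket_mul_of_bottomRatio d a κ hratio, eval_mul] at hE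
    have hS := eval_middleWeightedSum_neg hm d a hmid (hpos · x hx)
    have hb : (C (((d 2 : ℝ) - d 0) * κ) * X ^ (d 0) + C (-((d 2 : ℝ) - d 1)) * X ^ (d 1) : ℝ[X]).eval x = 0 :=
      (mul_eq_zero.1 hE).resolve_right hS.ne
    have hx0 : x ^ (d 0) ≠ 0 := pow_ne_zero _ hx.ne'
    have hev : (C (((d 2 : ℝ) - d 0) * κ) * X ^ (d 0) + C (-((d 2 : ℝ) - d 1)) * X ^ (d 1) : ℝ[X]).eval x
        = x ^ (d 0) * (((d 2 : ℝ) - d 0) * κ + ((d 2 : ℝ) - d 1) * (-1) * x ^ (d 1 - d 0)) := by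
      simp only [eval_add, eval_mul, eval_C, eval_pow, eval_X]
      rw [show x ^ (d 1) = x ^ (d 0) * x ^ (d 1 - d 0) by rw [← pow_add, Nat.add_sub_cancel' h01.le]]
      ring
    rw [hev] at hb
    exact (mul_eq_zero.1 hb).resolve_left hx0
  refine card_le_one.2 fun x hx y hy => ?_
  simp only [mem_filter, Multiset.mem_toFinset] at hx hy
  exact topBracket_root_unique d h01 h12 κ (by norm_num : (-1 : ℝ) < 0) hx.2 hy.2 (key x hx.2 (mem_roots'.1 hx.1).2)
    (key y hy.2 (mem_roots'.1 hy.1).2)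

/-- ★★ **COMMON-BOTTOM-RATIO LAW (exact)**: as above with `m ≥ 1` and `κ > 0`: EXACTLY ONE positive root (the common top bracket point). [folklore] -/
theorem euler_top_card_posRoots_eq_one_of_bottomRatio {m : ℕ} (hm : 0 < m) (d : Fin 3 → ℕ) (h01 : d 0 < d 1) (h12 : d 1 < d 2)
    (a : Fin m → Fin 3 → ℝ) (hmid : ∀ j, a j 1 < 0) {κ : ℝ} (hκ : 0 < κ) (hratio : ∀ j, a j 0 = -κ * a j 1)
    (hpos : ∀ i, ∀ x : ℝ, 0 < x → 0 < ∑ l, a i l * x ^ (d l)) :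
    ((∑ j, (∑ l, C (a j l * ((d l : ℝ) - d 2)) * X ^ (d l)) * ∏ i ∈ Finset.univ.erase j, (∑ l, C (a i l) * X ^ (d l))
        : ℝ[X]).roots.toFinset.filter (fun t => 0 < t)).card = 1 := by
  classical
  refine le_antisymm (euler_top_card_posRoots_le_one_of_bottomRatio d h01 h12 a hmid κ hratio hpos) ?_
  obtain ⟨x₀, hx₀, hbx₀⟩ := exists_topBracket_root d h01 h12 hκ (by norm_num : (-1 : ℝ) < 0)
  have hB0 : ∀ j, ∑ l, a j l * ((d l : ℝ) - d 2) * x₀ ^ (d l) = 0 := by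
    intro j
    rw [eval_eulerLetter_top d h01.le, hratio j]
    have : ((d 2 : ℝ) - d 0) * (-κ * a j 1) + ((d 2 : ℝ) - d 1) * a j 1 * x₀ ^ (d 1 - d 0)
        = -(a j 1) * (((d 2 : ℝ) - d 0) * κ + ((d 2 : ℝ) - d 1) * (-1) * x₀ ^ (d 1 - d 0)) := by ring
    rw [this, hbx₀, mul_zero, mul_zero, neg_zero]
  have hE0 := euler_eval_eq_zero_of_letters_eq_zero d a 2 hB0
  have hx1 : 0 < x₀ + 1 := by linarith
  have hne : ((∑ j, (∑ l, C (a j l * ((d l : ℝ) - d 2)) * X ^ (d l)) * ∏ i ∈ Finset.univ.erase j, (∑ l, C (a i l) * X ^ (d l))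
      : ℝ[X])) ≠ 0 := by
    intro h0
    have hB : ∀ j, 0 < ∑ l, a j l * ((d l : ℝ) - d 2) * (x₀ + 1) ^ (d l) := by
      intro j
      rw [eval_eulerLetter_top d h01.le, hratio j]
      have hlt := topBracket_lt d h01 h12 κ (by norm_num : (-1 : ℝ) < 0) hx₀.le (show x₀ < x₀ + 1 by linarith)
      have : ((d 2 : ℝ) - d 0) * (-κ * a j 1) + ((d 2 : ℝ) - d 1) * a j 1 * (x₀ + 1) ^ (d 1 - d 0)
          = -(a j 1) * (((d 2 : ℝ) - d 0) * κ + ((d 2 : ℝ) - d 1) * (-1) * (x₀ + 1) ^ (d 1 - d 0)) := by ring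
      rw [this]
      refine neg_pos.2 (mul_neg_of_pos_of_neg (pow_pos hx1 _) ?_)
      exact mul_neg_of_pos_of_neg (neg_pos.2 (hmid j)) (by linarith)
    have h1 := euler_eval_pos_of_letters_pos hm d a 2 (fun i => hpos i _ hx1) hB
    rw [h0, eval_zero] at h1
    exact lt_irrefl _ h1
  refine one_le_card.2 ⟨x₀, ?_⟩
  simp only [mem_filter, Multiset.mem_toFinset]
  exact ⟨(mem_roots hne).2 hE0, hx₀⟩

end ProductPlusOne

end Summit.ValiantsHypothesis.ValiantsHypothesis.Theorems.LacunarySymmetroidMatrixDescartes
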